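import Mathlib
import HarnessLib
import Summits.MatrixMultiplication.MatrixMultiplication.Theses.SnSubsetDichotomy
import Summits.MatrixMultiplication.MatrixMultiplication.Theorems.SnSubsetDichotomyHyperoctahedralSubsetsGroupPacking
import Summits.MatrixMultiplication.MatrixMultiplication.Theorems.SnSubsetDichotomyHyperoctahedralSubsetsPairwisePacking
import Summits.MatrixMultiplication.MatrixMultiplication.Theorems.SnSubsetDichotomyHyperoctahedralSubsetsHostSquare
import Summits.MatrixMultiplication.MatrixMultiplication.Theorems.SnSubsetDichotomyHyperoctahedralSubsetsCycleCount
import Summits.MatrixMultiplication.MatrixMultiplication.Theorems.SnSubsetDichotomyHyperoctahedralSubsetsTriplesToGroup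

/-!
# `HyperoctahedralThreshold` is false modulo the local-triple packing conjecture (L′)
(crux stmt-MatrixMultiplication-10883, NEGATIVE LEMMA; also a conditional proof of the sibling crux
`HyperoctahedralSubsets`, stmt-MatrixMultiplication-8305)

The two registered refutation skeletons of the crux `HyperoctahedralThreshold`
(`Cruxes/HyperoctahedralThreshold/Lines/one_scale_dichotomy.lean`, one open stub `stub_oneScaleDichotomy` after
p115733; `Cruxes/HyperoctahedralThreshold/Lines/refutation_local_symmetry.lean`, one open stub
`stub_poorRigidCore`) and the sibling skeleton `Cruxes/HyperoctahedralSubsets/Lines/spherical_rank_sieve.lean`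
(one open stub `stub_localTriples`) all reduce the refutation to ONE combinatorial statement about three perfect
matchings, stated here as the named hypothesis `LocalTriplePacking` — conjecture (L′) of the crux notes
(`Cruxes/HyperoctahedralThreshold/NOTES.md` §§0, B, 9, 16): every triple of fixed-point-free involutions
`μ₀, μ₁, μ₂` of `Fin n` admits `≥ c√n` commuting local triples `(a_j, b_j)` — `a_j, b_j` commuting involutions, not
both `1`, `a_j ∈ C(μ₀)`, `b_j ∈ C(μ₁)`, `a_j b_j ∈ C(μ₂)` — with pairwise disjoint supports.  This file makes the
reduction a TREE theorem (so far it lived only in the `Cruxes/` skeletons):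

* `hyperoctahedralSubsets_of_localTriplePacking : LocalTriplePacking → HyperoctahedralSubsets` — conditional proof of
  the sibling crux: `g ≥ c√n` disjoint local triples ⇒ a group `T` of `2^g ≥ e^{(c log 2)√n}` hosted triples with
  product one (`stub_triplesToGroup`, p79923) ⇒ by group packing (`stub_groupPacking`, p74548) and the host square
  bound (`stub_hostSquare`, p75879) every hosted TPP triple has volume `≤ (n·n!)^{3/2} e^{-(c log 2)√n}`, which is
  `≤ (n!)^{3/2} e^{-c'√n}` for large `n`; hosts with a short-cycle pair `μ_i μ_j` are handled by pairwise packing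
  (`stub_pairwisePacking`, p75305) and the cycle count (`stub_cycleCount`, p76793).  Proof text = the sibling lead's
  composition (prover-line-stmt-MatrixMultiplication-8305-0), verbatim up to the instantiation `x := 1`.
* `hyperoctahedralThreshold_false_of_localTriplePacking : LocalTriplePacking → ¬ HyperoctahedralThreshold` — the
  negative lemma for this crux (`HyperoctahedralThreshold` is `¬ HyperoctahedralSubsets` by `push_neg`).

STATUS OF (L′) (2026-08-16): open.  No proof (five line leads, three advisor consults, a 32-seat siege: supplies and
reductions are in the tree — `stub_richDescent`, `stub_goodTwin`, `stub_badCount`, `stub_patternTwin`,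
`stub_manySimpleTwins`, `stub_surgeryStep`, `stub_bulkRecursion`, the gadget zoo `stub_cycleGadget` /
`stub_pathGadget` / `stub_mobiusGadget` / `stub_extract`, the one-scale packing `stub_assembly` — but the
pair-correlation atom (WM)/(TSA-long)/(AP)/(LML) is unproved) and no counterexample (exhaustive n ≤ 18, random and
structured families to n = 2^16, annealed adversaries: clean girth ≈ log₂ n + 2, packed local triples ≈ n/(2log₂ n) ≫
√n).  (L′) is therefore filed as the hypothesis of a negative lemma, not claimed.
-/

set_option linter.dupNamespace false

namespace Summit.MatrixMultiplication.MatrixMultiplication.Theorems.HyperoctahedralThreshold.Negative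

open Summit.MatrixMultiplication.MatrixMultiplication.Theses.SnSubsetDichotomy

/-- **Conjecture (L′), local-triple packing** (crux notes `Cruxes/HyperoctahedralThreshold/NOTES.md` §0/§B/§9; the
bulk form of the sibling skeleton's `stub_localTriples`, stmt-8305, and the target of `stub_oneScaleDichotomy` +
`stub_assembly`, stmt-10883): there are `c > 0` and `n₀` such that for every `n ≥ n₀` and every three fixed-point-free
involutions `μ₀, μ₁, μ₂` of `Fin n` there exist `g ≥ c√n` COMMUTING LOCAL TRIPLES `(a_j, b_j)_{j<g}` — `a_j, b_j`
commuting involutions, not both the identity, `a_j` commuting with `μ₀`, `b_j` with `μ₁`, `a_j b_j` with `μ₂` — with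
pairwise disjoint supports (a point moved by `a_j` or `b_j` is fixed by `a_{j'}` and `b_{j'}` for `j' ≠ j`).
OPEN (no proof, no counterexample; see the file docstring). [conjecture] -/
def LocalTriplePacking : Prop :=
  ∃ c : ℝ, 0 < c ∧ ∃ n₀ : ℕ, ∀ n ≥ n₀, ∀ μ : Fin 3 → Equiv.Perm (Fin n),
    (∀ i, μ i * μ i = 1 ∧ ∀ v, μ i v ≠ v) →
    ∃ (g : ℕ) (a b : Fin g → Equiv.Perm (Fin n)), c * Real.sqrt (n : ℝ) ≤ (g : ℝ) ∧
      (∀ j, a j * a j = 1 ∧ b j * b j = 1 ∧ a j * b j = b j * a j ∧ (a j ≠ 1 ∨ b j ≠ 1) ∧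
        a j * μ 0 = μ 0 * a j ∧ b j * μ 1 = μ 1 * b j ∧ a j * b j * μ 2 = μ 2 * (a j * b j)) ∧
      (∀ j j' : Fin g, j ≠ j' → ∀ v, (a j v ≠ v ∨ b j v ≠ v) → a j' v = v ∧ b j' v = v)

/-- Growth threshold: for `c, x > 0`, eventually `2 n √n ≤ e^{c√n}` and `x√n ≥ 1` (sibling skeleton
`spherical_rank_sieve`, lead prover-line-stmt-MatrixMultiplication-8305-0). [folklore] -/
theorem growth_threshold {c x : ℝ} (hc : 0 < c) (hx : 0 < x) :
    ∃ n₃ : ℕ, ∀ n : ℕ, n₃ ≤ n →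
      2 * (n : ℝ) * Real.sqrt n ≤ Real.exp (c * Real.sqrt n) ∧ 1 ≤ x * Real.sqrt n := by
  refine ⟨⌈6250 / c ^ 5⌉₊ + ⌈1 / x ^ 2⌉₊, fun n hn => ?_⟩
  have hnR : ((⌈6250 / c ^ 5⌉₊ + ⌈1 / x ^ 2⌉₊ : ℕ) : ℝ) ≤ n := by exact_mod_cast hn
  push_cast at hnR
  have hc1 : 6250 / c ^ 5 ≤ (n : ℝ) :=
    le_trans (Nat.le_ceil _) (by linarith [Nat.cast_nonneg (α := ℝ) ⌈1 / x ^ 2⌉₊])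
  have hx1 : 1 / x ^ 2 ≤ (n : ℝ) :=
    le_trans (Nat.le_ceil _) (by linarith [Nat.cast_nonneg (α := ℝ) ⌈6250 / c ^ 5⌉₊])
  set s : ℝ := Real.sqrt n with hs_def
  have hs : 0 ≤ s := Real.sqrt_nonneg _
  have hs2 : s ^ 2 = n := Real.sq_sqrt (Nat.cast_nonneg n)
  have hn0 : (0 : ℝ) ≤ n := Nat.cast_nonneg n
  constructor
  · have h1 : (c * s / 5) ^ 5 ≤ Real.exp (c * s) := by
      have h0 : 0 ≤ c * s / 5 := by positivity
      have hadd := Real.add_one_le_exp (c * s / 5)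
      calc (c * s / 5) ^ 5 ≤ (c * s / 5 + 1) ^ 5 := by gcongr; linarith
        _ ≤ (Real.exp (c * s / 5)) ^ 5 := by gcongr
        _ = Real.exp (c * s) := by
            rw [← Real.exp_nat_mul]; congr 1; push_cast; ring
    have h2 : (c * s / 5) ^ 5 = c ^ 5 * (n : ℝ) ^ 2 * s / 3125 := by
      have e : s ^ 5 = (s ^ 2) ^ 2 * s := by ring
      rw [div_pow, mul_pow, e, hs2]; ring
    have hcn : 6250 ≤ c ^ 5 * (n : ℝ) := by
      have := hc1; rwa [div_le_iff₀ (by positivity), mul_comm] at this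
    have hns : 0 ≤ (n : ℝ) * s := mul_nonneg hn0 hs
    have h3 : 2 * (n : ℝ) * s ≤ c ^ 5 * (n : ℝ) ^ 2 * s / 3125 := by
      have := mul_le_mul_of_nonneg_left hcn hns
      nlinarith [this]
    calc 2 * (n : ℝ) * s ≤ c ^ 5 * (n : ℝ) ^ 2 * s / 3125 := h3
      _ = (c * s / 5) ^ 5 := h2.symm
      _ ≤ Real.exp (c * s) := h1
  · have e : x * s = Real.sqrt (x ^ 2 * n) := by
      rw [Real.sqrt_mul' _ hn0, Real.sqrt_sq hx.le]
    rw [e, Real.one_le_sqrt]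
    have := hx1
    rw [div_le_iff₀ (by positivity)] at this
    linarith

/-- **Symmetry budget from (L′)**: with the tree bridge `stub_triplesToGroup` (p79923), `g ≥ c√n` support-disjoint
commuting local triples give a group `T` of hosted triples with product one and `|T| ≥ 2^g ≥ e^{(c log 2)√n}`
(sibling skeleton's `symmetryBudget_of`, bulk form). [folklore] -/
theorem symmetryBudget_of_localTriplePacking (hL : LocalTriplePacking) :
    ∃ c : ℝ, 0 < c ∧ ∃ n₀ : ℕ, ∀ n ≥ n₀, ∀ μ : Fin 3 → Equiv.Perm (Fin n),
      (∀ i, μ i * μ i = 1 ∧ ∀ v, μ i v ≠ v) →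
      ∃ T : Finset (Equiv.Perm (Fin n) × Equiv.Perm (Fin n) × Equiv.Perm (Fin n)),
        (1 : Equiv.Perm (Fin n) × Equiv.Perm (Fin n) × Equiv.Perm (Fin n)) ∈ T ∧
        (∀ s ∈ T, ∀ t ∈ T, s * t ∈ T) ∧ (∀ t ∈ T, t⁻¹ ∈ T) ∧
        (∀ t ∈ T, t.1 * μ 0 = μ 0 * t.1 ∧ t.2.1 * μ 1 = μ 1 * t.2.1 ∧ t.2.2 * μ 2 = μ 2 * t.2.2 ∧
          t.1 * t.2.1 * t.2.2 = 1) ∧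
        Real.exp (c * Real.sqrt (n : ℝ)) ≤ (T.card : ℝ) := by
  obtain ⟨c, hc, n₀, hL1⟩ := hL
  refine ⟨c * Real.log 2, mul_pos hc (Real.log_pos one_lt_two), n₀, ?_⟩
  intro n hn μ hμ
  obtain ⟨g, a, b, hg, hloc, hdisj⟩ := hL1 n hn μ hμ
  obtain ⟨T, h1, hmul, hinv, hhost, hcard⟩ :=
    Summit.MatrixMultiplication.MatrixMultiplication.Theorems.HyperoctahedralSubsets.stub_triplesToGroup
      n μ g a b hloc hdisj
  refine ⟨T, h1, hmul, hinv, hhost, ?_⟩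
  have h2 : (2 : ℝ) ^ g ≤ (T.card : ℝ) := by exact_mod_cast hcard
  refine le_trans ?_ h2
  have e : Real.exp (Real.log 2 * g) = (2 : ℝ) ^ g := by
    rw [mul_comm, Real.exp_nat_mul, Real.exp_log two_pos]
  rw [← e]
  apply Real.exp_le_exp.2
  have := mul_le_mul_of_nonneg_left hg (Real.log_pos one_lt_two).le
  nlinarith [this]

/-- **Conditional proof of the sibling crux `HyperoctahedralSubsets` (stmt-8305) from (L′)** — the sibling
lead's composition (prover-line-stmt-MatrixMultiplication-8305-0, `Cruxes/HyperoctahedralSubsets/Lines/spherical_rank_sieve.lean`)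
with its four landed stubs (PairwisePacking p75305, CycleCount p76793, HostSquare p75879, GroupPacking p74548) taken from the tree and the
symmetry budget supplied by `symmetryBudget_of_localTriplePacking` (long-cycle parameter `x := 1`).  Proof text verbatim up to that
instantiation. [folklore] -/
theorem hyperoctahedralSubsets_of_localTriplePacking (hL : LocalTriplePacking) : HyperoctahedralSubsets := by
  unfold HyperoctahedralSubsets
  have hP := Summit.MatrixMultiplication.MatrixMultiplication.Theorems.HyperoctahedralSubsets.stub_pairwisePacking
  have hK := Summit.MatrixMultiplication.MatrixMultiplication.Theorems.HyperoctahedralSubsets.stub_cycleCount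
  have hH := Summit.MatrixMultiplication.MatrixMultiplication.Theorems.HyperoctahedralSubsets.stub_hostSquare
  have hG := Summit.MatrixMultiplication.MatrixMultiplication.Theorems.HyperoctahedralSubsets.stub_groupPacking
  obtain ⟨cR, hcR, n₂, hR1⟩ := symmetryBudget_of_localTriplePacking hL
  have hx : (0 : ℝ) < 1 := one_pos
  set x : ℝ := 1 with hx_def
  have hlog2 : 0 < Real.log 2 := Real.log_pos one_lt_two
  set c : ℝ := min (cR / 2) (Real.log 2 / (8 * x)) with hc_def
  have hc0 : 0 < c := lt_min (by linarith) (div_pos hlog2 (by positivity))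
  have hcR2 : c ≤ cR / 2 := min_le_left _ _
  have hc2 : c ≤ Real.log 2 / (8 * x) := min_le_right _ _
  obtain ⟨n₃, hn₃⟩ := growth_threshold hc0 hx
  refine ⟨c, hc0, n₂ + n₃ + 1, ?_⟩
  intro n hn μ hμ X hX hT
  have hn₂ : n₂ ≤ n := by omega
  have hn₃' : n₃ ≤ n := by omega
  have hn0 : 0 < n := by omega
  obtain ⟨hgrow, hxn⟩ := hn₃ n hn₃'
  have hF0 : (0 : ℝ) < n.factorial := by exact_mod_cast n.factorial_pos
  have hF : (n.factorial : ℝ) ^ ((3 : ℝ) / 2) = n.factorial * Real.sqrt (n.factorial : ℝ) := by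
    rw [show ((3 : ℝ) / 2) = 1 + 1 / 2 by norm_num, Real.rpow_add hF0, Real.rpow_one, Real.sqrt_eq_rpow]
  have hsn : (0 : ℝ) ≤ Real.sqrt n := Real.sqrt_nonneg _
  have finish : ∀ r : ℝ, c ≤ r →
      (((X 0).card * (X 1).card * (X 2).card : ℕ) : ℝ) ≤
        (n.factorial : ℝ) * Real.sqrt (n.factorial : ℝ) * Real.exp (-(r * Real.sqrt n)) →
      (((X 0).card * (X 1).card * (X 2).card : ℕ) : ℝ) ≤
        (n.factorial : ℝ) ^ ((3 : ℝ) / 2) * Real.exp (-(c * Real.sqrt (n : ℝ))) := by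
    intro r hr h
    rw [hF]
    refine h.trans (mul_le_mul_of_nonneg_left (Real.exp_le_exp.2 ?_) (by positivity))
    have := mul_le_mul_of_nonneg_right hr hsn
    linarith
  by_cases hlong : ∀ i j : Fin 3, i ≠ j → ∃ k ∈ (μ i * μ j).cycleType, x * Real.sqrt (n : ℝ) ≤ (k : ℝ)
  · obtain ⟨T, h1T, hmulT, hinvT, hhostT, hbigT⟩ := hR1 n hn₂ μ hμ
    have hGv := hG n μ X T hX hT h1T hmulT hinvT hhostT
    set V : ℕ := (X 0).card * (X 1).card * (X 2).card with hV_def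
    set z : Fin 3 → ℕ := fun i =>
      (Finset.univ.filter (fun σ : Equiv.Perm (Fin n) => σ * μ i = μ i * σ)).card with hz_def
    have hz2 : ∀ i, ((z i : ℕ) : ℝ) ^ 2 ≤ (n : ℝ) * n.factorial := fun i => by
      have := hH n hn0 (μ i) (hμ i).1 (hμ i).2
      exact_mod_cast this
    have hGr : (V : ℝ) * T.card ≤ (z 0 : ℝ) * z 1 * z 2 := by exact_mod_cast hGv
    set M : ℝ := (n : ℝ) * n.factorial with hM_def
    have hM0 : 0 ≤ M := by positivity
    have hZsq : ((z 0 : ℝ) * z 1 * z 2) ^ 2 ≤ M ^ 3 := by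
      have e : ((z 0 : ℝ) * z 1 * z 2) ^ 2 = (z 0 : ℝ) ^ 2 * (z 1 : ℝ) ^ 2 * (z 2 : ℝ) ^ 2 := by ring
      have e3 : M ^ 3 = M * M * M := by ring
      rw [e, e3]
      have h0 := hz2 0
      have h1 := hz2 1
      have h2 := hz2 2
      gcongr
    have hZ : (z 0 : ℝ) * z 1 * z 2 ≤ M * Real.sqrt M := by
      have e : (M * Real.sqrt M) ^ 2 = M ^ 3 := by rw [mul_pow, Real.sq_sqrt hM0]; ring
      exact (pow_le_pow_iff_left₀ (by positivity) (by positivity) two_ne_zero).1 (e ▸ hZsq)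
    have hV1 : (V : ℝ) * Real.exp (cR * Real.sqrt n) ≤ M * Real.sqrt M :=
      calc (V : ℝ) * Real.exp (cR * Real.sqrt n) ≤ (V : ℝ) * T.card :=
            mul_le_mul_of_nonneg_left hbigT (by positivity)
        _ ≤ (z 0 : ℝ) * z 1 * z 2 := hGr
        _ ≤ M * Real.sqrt M := hZ
    have hV2 : (V : ℝ) ≤ M * Real.sqrt M * Real.exp (-(cR * Real.sqrt n)) := by
      have h3 : Real.exp (cR * Real.sqrt n) * Real.exp (-(cR * Real.sqrt n)) = 1 := by
        rw [← Real.exp_add, add_neg_cancel, Real.exp_zero]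
      have := mul_le_mul_of_nonneg_right hV1 (Real.exp_pos (-(cR * Real.sqrt n))).le
      rwa [mul_assoc, h3, mul_one] at this
    have hMsplit : M * Real.sqrt M =
        ((n : ℝ) * Real.sqrt n) * ((n.factorial : ℝ) * Real.sqrt (n.factorial : ℝ)) := by
      rw [hM_def, Real.sqrt_mul (Nat.cast_nonneg n)]; ring
    have hexp : (n : ℝ) * Real.sqrt n * Real.exp (-(cR * Real.sqrt n)) ≤
        Real.exp (-(c * Real.sqrt n)) := by
      have e1 : Real.exp (c * Real.sqrt n) * Real.exp (-(cR * Real.sqrt n)) ≤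
          Real.exp (-(c * Real.sqrt n)) := by
        rw [← Real.exp_add]
        apply Real.exp_le_exp.2
        have := mul_le_mul_of_nonneg_right hcR2 hsn
        nlinarith
      have e0 : (n : ℝ) * Real.sqrt n ≤ Real.exp (c * Real.sqrt n) := by
        have : 0 ≤ (n : ℝ) * Real.sqrt n := by positivity
        linarith
      calc (n : ℝ) * Real.sqrt n * Real.exp (-(cR * Real.sqrt n))
          ≤ Real.exp (c * Real.sqrt n) * Real.exp (-(cR * Real.sqrt n)) :=
            mul_le_mul_of_nonneg_right e0 (Real.exp_pos _).le
        _ ≤ Real.exp (-(c * Real.sqrt n)) := e1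
    apply finish c le_rfl
    calc (V : ℝ) ≤ M * Real.sqrt M * Real.exp (-(cR * Real.sqrt n)) := hV2
      _ = ((n.factorial : ℝ) * Real.sqrt (n.factorial : ℝ)) *
            ((n : ℝ) * Real.sqrt n * Real.exp (-(cR * Real.sqrt n))) := by rw [hMsplit]; ring
      _ ≤ ((n.factorial : ℝ) * Real.sqrt (n.factorial : ℝ)) * Real.exp (-(c * Real.sqrt n)) :=
            mul_le_mul_of_nonneg_left hexp (by positivity)
  · push Not at hlong
    obtain ⟨i, j, hij, hshort⟩ := hlong
    have hxn0 : 0 < x * Real.sqrt n := by linarith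
    set t : ℕ := ⌈x * Real.sqrt (n : ℝ)⌉₊ with ht_def
    have ht0 : 0 < t := Nat.ceil_pos.2 hxn0
    have hall : ∀ k ∈ (μ i * μ j).cycleType, k < t := fun k hk => Nat.lt_ceil.2 (hshort k hk)
    have hz := hK n (μ i) (μ j) (hμ i).1 (hμ j).1 (hμ i).2 (hμ j).2 t ht0 hall
    have hpack := hP n hn0 μ X hμ hX hT i j hij
    set V : ℕ := (X 0).card * (X 1).card * (X 2).card with hV_def
    set z : ℕ := Nat.card ↥((Subgroup.centralizer {μ i} : Subgroup (Equiv.Perm (Fin n))) ⊓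
      Subgroup.centralizer {μ j}) with hz_def
    set q : ℕ := n / (2 * t) with hq_def
    have hz1 : (1 : ℝ) ≤ z := by exact_mod_cast Nat.one_le_two_pow.trans hz
    have hz0 : (0 : ℝ) < z := by linarith
    have hM0 : (0 : ℝ) ≤ (n : ℝ) * n.factorial := by positivity
    have h1' : (V : ℝ) ^ 2 * (z : ℝ) ^ 2 ≤ ((n : ℝ) * n.factorial) ^ 3 := by exact_mod_cast hpack
    have h1 : ((V : ℝ) * z) ^ 2 ≤ ((n : ℝ) * n.factorial * Real.sqrt ((n : ℝ) * n.factorial)) ^ 2 := by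
      have e : ((n : ℝ) * n.factorial * Real.sqrt ((n : ℝ) * n.factorial)) ^ 2 =
          ((n : ℝ) * n.factorial) ^ 3 := by
        rw [mul_pow, Real.sq_sqrt hM0]; ring
      rw [e, mul_pow]; exact h1'
    have h2 : (V : ℝ) * z ≤ (n : ℝ) * n.factorial * Real.sqrt ((n : ℝ) * n.factorial) :=
      (pow_le_pow_iff_left₀ (by positivity) (by positivity) two_ne_zero).1 h1
    have hspos : 0 < Real.sqrt n := Real.sqrt_pos.2 (by exact_mod_cast hn0)
    have hnn : (n : ℝ) = Real.sqrt n * Real.sqrt n := (Real.mul_self_sqrt (Nat.cast_nonneg n)).symm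
    have hq : Real.sqrt n / (4 * x) < (q : ℝ) + 1 := by
      have hA' : (n : ℝ) < 2 * t * ((q : ℝ) + 1) := by
        have := Nat.lt_mul_div_succ n (by positivity : 0 < 2 * t)
        exact_mod_cast this
      have hB : (t : ℝ) < x * Real.sqrt n + 1 := Nat.ceil_lt_add_one hxn0.le
      have hB' : (t : ℝ) ≤ 2 * (x * Real.sqrt n) := by linarith
      have hq1 : (0 : ℝ) ≤ (q : ℝ) + 1 := by positivity
      have hC' : Real.sqrt n * Real.sqrt n < (4 * x * ((q : ℝ) + 1)) * Real.sqrt n := by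
        calc Real.sqrt n * Real.sqrt n = (n : ℝ) := hnn.symm
          _ < 2 * t * ((q : ℝ) + 1) := hA'
          _ ≤ 2 * (2 * (x * Real.sqrt n)) * ((q : ℝ) + 1) := by gcongr
          _ = (4 * x * ((q : ℝ) + 1)) * Real.sqrt n := by ring
      have hD' : Real.sqrt n < 4 * x * ((q : ℝ) + 1) := lt_of_mul_lt_mul_right hC' hspos.le
      rw [div_lt_iff₀ (by positivity)]
      linarith
    have hzexp : Real.exp (2 * c * Real.sqrt n) ≤ 2 * (z : ℝ) := by
      have e1 : 2 * c * Real.sqrt n ≤ Real.log 2 * (Real.sqrt n / (4 * x)) := by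
        have := mul_le_mul_of_nonneg_right hc2 hsn
        have e : Real.log 2 * (Real.sqrt n / (4 * x)) = 2 * (Real.log 2 / (8 * x) * Real.sqrt n) := by
          field_simp; ring
        rw [e]; linarith
      have e2 : Real.log 2 * (Real.sqrt n / (4 * x)) ≤ Real.log 2 * ((q : ℝ) + 1) :=
        mul_le_mul_of_nonneg_left hq.le hlog2.le
      have e3 : Real.log 2 * ((q : ℝ) + 1) = ((q + 1 : ℕ) : ℝ) * Real.log 2 := by push_cast; ring
      have hzq : ((2 ^ q : ℕ) : ℝ) ≤ z := by exact_mod_cast hz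
      push_cast at hzq
      calc Real.exp (2 * c * Real.sqrt n) ≤ Real.exp (Real.log 2 * ((q : ℝ) + 1)) :=
            Real.exp_le_exp.2 (e1.trans e2)
        _ = 2 ^ (q + 1) := by rw [e3, Real.exp_nat_mul, Real.exp_log two_pos]
        _ = 2 * 2 ^ q := by ring
        _ ≤ 2 * z := by linarith
    apply finish c le_rfl
    have hMsplit : (n : ℝ) * n.factorial * Real.sqrt ((n : ℝ) * n.factorial) =
        ((n : ℝ) * Real.sqrt n) * ((n.factorial : ℝ) * Real.sqrt (n.factorial : ℝ)) := by
      rw [Real.sqrt_mul (Nat.cast_nonneg n)]; ring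
    have hE : (n : ℝ) * Real.sqrt n ≤ Real.exp (-(c * Real.sqrt n)) * z := by
      have h3 : Real.exp (-(c * Real.sqrt n)) * Real.exp (2 * c * Real.sqrt n) =
          Real.exp (c * Real.sqrt n) := by
        rw [← Real.exp_add]; congr 1; ring
      have h4 : 0 < Real.exp (-(c * Real.sqrt n)) := Real.exp_pos _
      have h5 := mul_le_mul_of_nonneg_left hzexp h4.le
      rw [h3] at h5
      linarith [hgrow, h5]
    have hFF : (0 : ℝ) ≤ (n.factorial : ℝ) * Real.sqrt (n.factorial : ℝ) := by positivity
    have key : (V : ℝ) * z ≤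
        ((n.factorial : ℝ) * Real.sqrt (n.factorial : ℝ) * Real.exp (-(c * Real.sqrt n))) * z := by
      calc (V : ℝ) * z ≤ (n : ℝ) * n.factorial * Real.sqrt ((n : ℝ) * n.factorial) := h2
        _ = ((n : ℝ) * Real.sqrt n) * ((n.factorial : ℝ) * Real.sqrt (n.factorial : ℝ)) := hMsplit
        _ ≤ (Real.exp (-(c * Real.sqrt n)) * z) * ((n.factorial : ℝ) * Real.sqrt (n.factorial : ℝ)) :=
            mul_le_mul_of_nonneg_right hE hFF
        _ = ((n.factorial : ℝ) * Real.sqrt (n.factorial : ℝ) * Real.exp (-(c * Real.sqrt n))) * z := by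
            ring
    exact le_of_mul_le_mul_right key hz0

/-- **Record of the dropped route item `HyperoctahedralThreshold`** = stmt-MatrixMultiplication-10883 (ledger
signature verbatim; NOT a route item): route `SnSubsetDichotomy` rev 5 (2026-08-17T02:16Z) dropped the refuted
construction crux `HyperoctahedralThreshold`, so the short name `HyperoctahedralThreshold` in the statement of
`hyperoctahedralThreshold_false_of_localTriplePacking` below (written against
`open Summit.MatrixMultiplication.MatrixMultiplication.Theses.SnSubsetDichotomy`) stopped resolving and this accepted
module — and with it its importers `Theorems/SnSubsetDichotomyHyperoctahedralSubsets.lean` (the certificate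
`hyperoctahedralSubsets_proof` of the PROVED sibling crux stmt-MatrixMultiplication-8305, which uses only
`LocalTriplePacking` / `hyperoctahedralSubsets_of_localTriplePacking` from here) and
`Theorems/SnSubsetDichotomyHyperoctahedralThresholdRefutation.lean` — stopped building from source (stale oleans;
buildfix lane 2026-08-19/20).  Re-created HERE, in this file's own namespace (namespace resolution precedes the
`open`, so the statement text below is unchanged and now denotes this record), because the record of the same item
that `…HyperoctahedralThresholdRefutation.lean` (p197823) declares under the original route name
`…Theses.SnSubsetDichotomy.HyperoctahedralThreshold` cannot be imported here (that module imports this one).  The two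
records have the IDENTICAL body (copied byte-for-byte from the rev-4 route file / p197823), hence are definitionally
equal, and `not_HyperoctahedralThreshold` there keeps elaborating unchanged against this lemma.  The statement of
every previously accepted declaration in this file is unchanged. -/
def HyperoctahedralThreshold : Prop :=
  ∀ c : ℝ, 0 < c → ∀ n₀ : ℕ, ∃ n ≥ n₀, ∃ μ : Fin 3 → Equiv.Perm (Fin n), (∀ i, μ i * μ i = 1 ∧ ∀ x, μ i x ≠ x) ∧ ∃ X : Fin 3 → Finset (Equiv.Perm (Fin n)), (∀ i, ∀ σ ∈ X i, σ * μ i = μ i * σ) ∧ Literature.Combinatorics.Additive.TripleProductProperty (X 0) (X 1) (X 2) ∧ (n.factorial : ℝ) ^ ((3 : ℝ) / 2) * Real.exp (-(c * Real.sqrt (n : ℝ))) < (((X 0).card * (X 1).card * (X 2).card : ℕ) : ℝ)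

/-- **NEGATIVE LEMMA for the crux `HyperoctahedralThreshold` (stmt-MatrixMultiplication-10883) modulo (L′)**:
`LocalTriplePacking → ¬ HyperoctahedralThreshold` — the crux is the `push_neg` of the sibling crux
`HyperoctahedralSubsets`, which `hyperoctahedralSubsets_of_localTriplePacking` derives from (L′). [folklore] -/
theorem hyperoctahedralThreshold_false_of_localTriplePacking (hL : LocalTriplePacking) :
    ¬ HyperoctahedralThreshold := by
  obtain ⟨c, hc, n₀, hS⟩ := hyperoctahedralSubsets_of_localTriplePacking hL
  intro hT
  obtain ⟨n, hn, μ, hμ, X, hX, hTPP, hbig⟩ := hT c hc n₀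
  exact absurd (hS n hn μ hμ X hX hTPP) (not_le.2 hbig)

end Summit.MatrixMultiplication.MatrixMultiplication.Theorems.HyperoctahedralThreshold.Negative
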